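import Mathlib
import Literature.AlgebraicGeometry.Resolution.CobordantGame
import Literature.AlgebraicGeometry.Resolution.CobordantArcLemma
import Literature.AlgebraicGeometry.Resolution.CobordantVertexChart
import Literature.AlgebraicGeometry.Resolution.CobordantChartCoefficients
import Literature.AlgebraicGeometry.Resolution.FormalInverseFunction
import Summits.ResolutionOfSingularities.ResolutionOfSingularities.Theorems.WeightedInvariantLocalWeightedDropGradedSliceRank

/-!
# `WeightedInvariant.LocalWeightedDrop`: the graded SLICE does NOT preserve the graded RANK — `(Z + y)^p` has no graded
# one-move win, yet is graded-won in two moves; R3-T3 `gradedWonBy_slice_iff` AS TYPED is refutable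

Route `ResolutionOfSingularities/WeightedInvariant`, crux `LocalWeightedDrop` (stmt-ResolutionOfSingularities-8899).
[OURS · L1 W4.3] — CHAIN w43 SEAT TABLE v7 row res-type-060 «idea-1's graded slices»; second half of the kernel PROBE of R3-T3
(ideator res-L1-w43-idea-1, Sketch-L1-idea-1.lean v3 `631198685223c190` §5, flagged CONJECTURAL there: «the `K`-descent of
successors when the stabiliser drops is the delicate step»).  First half: `WeightedInvariantLocalWeightedDropGradedSliceRank`
(the specimen `g = Z^p + (1+x)·y^p`, graded-won with rank `0`; its slice `Z^p + y^p`; the slice grading separates `y` from `s`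
and `Z`).  Nothing here is a statement of the manuscript under review on ladder RESOLUTION; R3-T3 is an OURS conjecture and this
file probes its TYPING — it is not a verdict on card A.  AI proof, weaker than expert review.

**Results (sorry-free, axioms standard; every field `k` of characteristic `p`, every prime `p`).**
* `not_gradedWonBy_zero_addPow` — **THE `p`-TH POWER OF A SMOOTH FORM THAT IS NOT A SEMI-INVARIANT HAS NO GRADED ONE-MOVE
  WIN**: for every lattice `L ⊆ ℤ³` with `e_s − e_y ∉ L` and `e_Z − e_y ∉ L`, `¬ GradedWonBy 0 3 L (Z^p + y^p)`.  For an
  `L`-graded move `(θ, w)` gradedness makes the linear part of `θ` block-triangular (`θ_y` has no `s`, `Z` terms; `θ_s`, `θ_Z` no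
  `y` term), so `m := θ(Z) + θ(y)` is SMOOTH with `∂m/∂y(0) ≠ 0` and `(∂m/∂s(0), ∂m/∂Z(0)) ≠ 0`, and `θ(Z^p + y^p) = m^p`
  (Frobenius).  The formal inverse function theorem (`FormalCoordChange.exists_comp_inverse` on the coordinate system `(s, Z, m)`)
  puts the arcs `t ↦ Ψ(αt, βt, 0)` on the smooth hypersurface `{m = 0}`; along them `m^p` and every `∂(m^p) = p·m^{p−1}·∂m = 0`
  vanish, and for a suitable `(α, β)` the arc leaves the centre `V(xᵢ : wᵢ > 0)`; the ARC LEMMA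
  (`CobordantArc.exists_offVertex_singular_of_arc`) then gives an exceptional point off the vertex whose `s`-saturated successor
  (`CobordantVertexChart.exists_eq_X_pow_mul_not_dvd`) is SINGULAR — divisorial and higher-codimension centres alike.
* (companion file `WeightedInvariantLocalWeightedDropGradedSliceRankOne`, `gradedWonBy_one_addPow`: `Z^p + y^p` IS
  graded-won with rank `1` for EVERY lattice — so for lattices separating `y` from `s`, `Z` its graded rank is EXACTLY `1`.)
* `gradedWonBy_zero_umbrella_and_not_slice` — the specimen assembled: `GradedWonBy 0` holds for `g = Z^p + (1+x)·y^p` in its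
  propagated grading and FAILS for `sliceGerm x g` in the slice grading.
* `not_gradedWonBy_slice_iff_asTyped` — **R3-T3 AS TYPED IS REFUTABLE**: its universal closure fails at `k = 𝔽₂`, `p = 2`, `α = 0`.

**Reading (input for res-L1-w43-idea-1 / lead-1 (registrar) / plan-1 / tri-1·2; words are theirs).**  «Same rank» is the
misstated clause: at a WILD point the `(n+1)`-variable successor is a TWISTED cylinder (`x·y^p` present) and can be strictly
easier than its slice, the honest `p`-th power `(Z + y)^p`, which must first spend one graded move killing its grading before the
form `Z + y` becomes a semi-invariant that a graded coordinate change may straighten.  What survives at the specimen: the rank-free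
form «`g` graded-won ↔ slice graded-won» (both are) and the one-sided «rank(slice) ≤ rank(g) + 1»; neither is claimed in general.
-/

set_option linter.dupNamespace false -- mandated namespace of this single-conjunct summit
set_option autoImplicit false

namespace Summit.ResolutionOfSingularities.ResolutionOfSingularities.Theorems

namespace GradedGame

open MvPowerSeries
open Literature.AlgebraicGeometry.Resolution
open Literature.AlgebraicGeometry.Resolution.CobordantChart (chart subst_chart_ne_zero)
open Literature.AlgebraicGeometry.Resolution.CobordantArc (exists_offVertex_singular_of_arc coeff_degree_one_subst
  linMat_mul_of_comp_eq_X constantCoeff_subst_arc_zero)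
open Literature.AlgebraicGeometry.Resolution.FormalCoordChange (linMat exists_comp_inverse)
open Literature.RingTheory.MvPowerSeries (pd pd_pow_succ)

variable {k : Type} [Field k]

/-! ## §1 `(Z + y)^p`: no graded one-move win -/

section AddPow

variable (p : ℕ) [hp : Fact p.Prime]

/-- **THE `p`-TH POWER OF A SMOOTH FORM THAT IS NOT A SEMI-INVARIANT HAS NO GRADED ONE-MOVE WIN** (every field of
characteristic `p`, every grading lattice `L ⊆ ℤ³` in which the characters of `s` and of `Z` both differ from that of `y`):
`¬ GradedWonBy 0 3 L (Z^p + y^p)`.  Proof: for an `L`-graded move `(θ, w)`, gradedness forces the linear part of `θ` to be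
block-triangular (`θ_y` has no `s`/`Z` term, `θ_s`, `θ_Z` have no `y` term), so `θ(Z + y) =: m` is a SMOOTH form with
`∂m/∂y(0) ≠ 0` and `(∂m/∂s(0), ∂m/∂Z(0)) ≠ 0`; `θ(Z^p + y^p) = m^p` (Frobenius); by the formal inverse function theorem
(`FormalCoordChange.exists_comp_inverse` applied to the coordinate system `(s, Z, m)`) the smooth hypersurface `{m = 0}` carries
the arcs `t ↦ Ψ(αt, βt, 0)`, along which `m^p` and all its partial derivatives (`= p·m^{p-1}·∂m = 0`) vanish, and one of them
leaves the centre `V(xᵢ : wᵢ > 0)`; the ARC LEMMA (`CobordantArc.exists_offVertex_singular_of_arc`) then produces an exceptional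
point off the vertex whose `s`-saturated successor is SINGULAR.  (The divisorial and the codimension-`≥ 2` centres are treated
uniformly by the arc.) [OURS · L1 W4.3] -/
theorem not_gradedWonBy_zero_addPow [CharP k p] (L : AddSubgroup (Fin 3 → ℤ))
    (h02 : (Pi.single 0 1 - Pi.single 2 1 : Fin 3 → ℤ) ∉ L) (h12 : (Pi.single 1 1 - Pi.single 2 1 : Fin 3 → ℤ) ∉ L) :
    ¬ GradedWonBy 0 3 L (X 1 ^ p + X 2 ^ p : MvPowerSeries (Fin 3) k) := by
  classical
  have hp0 : 0 < p := hp.out.pos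
  haveI : CharP (MvPowerSeries (Fin 3) k) p := charP_of_injective_ringHom MvPowerSeries.C_injective p
  rw [gradedWonBy_zero_iff]
  rintro ⟨θ, w, ⟨⟨hθ0, hdet, hwpos⟩, hgr⟩, hno⟩
  have hθ : HasSubst θ := hasSubst_of_constantCoeff_zero hθ0
  set A : Matrix (Fin 3) (Fin 3) k := Matrix.of fun i j => coeff (Finsupp.single j 1) (θ i) with hA
  -- gradedness kills four entries of the linear part `A`
  have hvan : ∀ i j : Fin 3, (Pi.single j 1 - Pi.single i 1 : Fin 3 → ℤ) ∉ L → A i j = 0 := by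
    intro i j hij
    by_contra hne
    have hmem := hgr i (Finsupp.single j 1) hne
    rw [expVec_single, Nat.cast_one] at hmem
    exact hij hmem
  have h20' : (Pi.single 2 1 - Pi.single 0 1 : Fin 3 → ℤ) ∉ L := fun h => h02 (by simpa [neg_sub] using L.neg_mem h)
  have h21' : (Pi.single 2 1 - Pi.single 1 1 : Fin 3 → ℤ) ∉ L := fun h => h12 (by simpa [neg_sub] using L.neg_mem h)
  have hA02 : A 0 2 = 0 := hvan 0 2 h20'
  have hA12 : A 1 2 = 0 := hvan 1 2 h21'
  have hA20 : A 2 0 = 0 := hvan 2 0 h02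
  have hA21 : A 2 1 = 0 := hvan 2 1 h12
  -- the determinant factors: `det A = A₂₂ · (A₀₀ A₁₁ − A₀₁ A₁₀)`
  have hdetA : A.det = A 2 2 * (A 0 0 * A 1 1 - A 0 1 * A 1 0) := by
    rw [Matrix.det_fin_three, hA02, hA12, hA20, hA21]; ring
  have h22 : A 2 2 ≠ 0 := by
    intro h
    rw [hdetA, h, zero_mul] at hdet
    exact not_isUnit_zero hdet
  have h1011 : A 1 0 ≠ 0 ∨ A 1 1 ≠ 0 := by
    by_contra hcon
    push Not at hcon
    rw [hdetA, hcon.1, hcon.2, mul_zero, mul_zero, sub_zero, mul_zero] at hdet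
    exact not_isUnit_zero hdet
  -- the transformed germ is the `p`-th power of the smooth form `m = θ_Z + θ_y`
  set m : MvPowerSeries (Fin 3) k := θ 1 + θ 2 with hm
  have hsub : subst θ (X 1 ^ p + X 2 ^ p : MvPowerSeries (Fin 3) k) = m ^ p := by
    rw [subst_add hθ, subst_pow hθ, subst_pow hθ, subst_X hθ, subst_X hθ, hm, add_pow_char]
  have hm0 : constantCoeff m = 0 := by rw [hm, map_add, hθ0, hθ0, add_zero]
  have hmlin : ∀ j, coeff (Finsupp.single j 1) m = A 1 j + A 2 j := by
    intro j; simp [hm, hA, map_add]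
  have hml0 : coeff (Finsupp.single 0 1) m = A 1 0 := by rw [hmlin, hA20, add_zero]
  have hml1 : coeff (Finsupp.single 1 1) m = A 1 1 := by rw [hmlin, hA21, add_zero]
  have hml2 : coeff (Finsupp.single 2 1) m = A 2 2 := by rw [hmlin, hA12, zero_add]
  have hmne : m ≠ 0 := fun h => h22 (by rw [← hml2, h, map_zero])
  -- the coordinate system `(s, Z, m)` and its formal inverse `Ψ`
  set Θ : Fin 3 → MvPowerSeries (Fin 3) k := ![X 0, X 1, m] with hΘ
  have hΘ0e : Θ 0 = X 0 := rfl
  have hΘ1e : Θ 1 = X 1 := rfl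
  have hΘ2e : Θ 2 = m := rfl
  have hΘ0 : ∀ i, constantCoeff (Θ i) = 0 := by
    intro i
    fin_cases i
    · simp [hΘ0e, constantCoeff_X]
    · simp [hΘ1e, constantCoeff_X]
    · simpa [hΘ2e] using hm0
  have hlinΘ : ∀ j, linMat Θ 2 j = coeff (Finsupp.single j 1) m := fun j => rfl
  have hlinΘ0 : ∀ j, linMat Θ 0 j = if j = 0 then 1 else 0 := by
    intro j
    show coeff (Finsupp.single j 1) (X 0 : MvPowerSeries (Fin 3) k) = _
    rw [coeff_X]
    simp [Finsupp.single_eq_single_iff]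
  have hlinΘ1 : ∀ j, linMat Θ 1 j = if j = 1 then 1 else 0 := by
    intro j
    show coeff (Finsupp.single j 1) (X 1 : MvPowerSeries (Fin 3) k) = _
    rw [coeff_X]
    simp [Finsupp.single_eq_single_iff]
  have hΘdet : IsUnit (linMat Θ).det := by
    have h : (linMat Θ).det = A 2 2 := by
      rw [Matrix.det_fin_three, hlinΘ, hlinΘ, hlinΘ, hlinΘ0, hlinΘ0, hlinΘ0, hlinΘ1, hlinΘ1, hlinΘ1, hml0, hml1, hml2]
      simp
    rw [h]
    exact isUnit_iff_ne_zero.mpr h22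
  obtain ⟨Ψ, hΨ0, hΨΘ, -⟩ := exists_comp_inverse hΘ0 hΘdet
  have hΨ : HasSubst Ψ := hasSubst_of_constantCoeff_zero hΨ0
  have hΨ0X : Ψ 0 = X 0 := by
    have h := hΨΘ 0
    rwa [hΘ0e, subst_X hΨ] at h
  have hΨ1X : Ψ 1 = X 1 := by
    have h := hΨΘ 1
    rwa [hΘ1e, subst_X hΨ] at h
  have hΨm : subst Ψ m = X 2 := hΨΘ 2
  -- the linear part `B` of `Ψ`: row 2 of `linMat Θ · B = 1`
  set B : Matrix (Fin 3) (Fin 3) k := Matrix.of fun i j => coeff (Finsupp.single j 1) (Ψ i) with hB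
  have hΘB : linMat Θ * B = 1 := linMat_mul_of_comp_eq_X hΨ0 hΨΘ
  have hB0 : ∀ j, B 0 j = if j = 0 then 1 else 0 := by
    intro j
    show coeff (Finsupp.single j 1) (Ψ 0) = _
    rw [hΨ0X, coeff_X]
    simp [Finsupp.single_eq_single_iff]
  have hB1 : ∀ j, B 1 j = if j = 1 then 1 else 0 := by
    intro j
    show coeff (Finsupp.single j 1) (Ψ 1) = _
    rw [hΨ1X, coeff_X]
    simp [Finsupp.single_eq_single_iff]
  have hrow : ∀ j, A 1 0 * B 0 j + A 1 1 * B 1 j + A 2 2 * B 2 j = if (2 : Fin 3) = j then 1 else 0 := by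
    intro j
    have h := congrFun (congrFun hΘB 2) j
    rw [Matrix.mul_apply, Fin.sum_univ_three, Matrix.one_apply, hlinΘ, hlinΘ, hlinΘ, hml0, hml1, hml2] at h
    exact h
  have hB20 : A 2 2 * B 2 0 = -A 1 0 := by
    have h := hrow 0
    rw [hB0, hB1, if_pos rfl, if_neg (by decide), if_neg (by decide)] at h
    linear_combination h
  have hB21 : A 2 2 * B 2 1 = -A 1 1 := by
    have h := hrow 1
    rw [hB0, hB1, if_neg (by decide), if_pos rfl, if_neg (by decide)] at h
    linear_combination h
  -- the arcs `t ↦ Ψ(αt, βt, 0)` on the smooth hypersurface `{m = 0}`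
  have hcX : ∀ a : k, MvPowerSeries.coeff (Finsupp.single () 1) (a • PowerSeries.X : PowerSeries k) = a := by
    intro a
    show MvPowerSeries.coeff (Finsupp.single () 1) (a • (MvPowerSeries.X () : MvPowerSeries Unit k)) = a
    rw [map_smul, MvPowerSeries.coeff_X, if_pos rfl, smul_eq_mul, mul_one]
  have harc : ∀ α β : k, ∃ Γ : Fin 3 → PowerSeries k, (∀ i, PowerSeries.constantCoeff (Γ i) = 0) ∧
      Γ 0 = α • PowerSeries.X ∧ Γ 1 = β • PowerSeries.X ∧
      A 2 2 * MvPowerSeries.coeff (Finsupp.single () 1) (Γ 2) = -(A 1 0 * α + A 1 1 * β) ∧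
      (MvPowerSeries.subst Γ m : PowerSeries k) = 0 ∧
      ∀ J, (MvPowerSeries.subst Γ (pd J (m ^ p)) : PowerSeries k) = 0 := by
    intro α β
    let γ : Fin 3 → PowerSeries k := ![α • PowerSeries.X, β • PowerSeries.X, 0]
    have hγ0e : γ 0 = α • PowerSeries.X := rfl
    have hγ1e : γ 1 = β • PowerSeries.X := rfl
    have hγ2e : γ 2 = 0 := rfl
    have hγ0 : ∀ i, PowerSeries.constantCoeff (γ i) = 0 := by
      intro i
      fin_cases i
      · simp [hγ0e]
      · simp [hγ1e]
      · simp [hγ2e]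
    have hγs : HasSubst γ := hasSubst_of_constantCoeff_zero hγ0
    have hΓ0 : ∀ i, PowerSeries.constantCoeff (MvPowerSeries.subst γ (Ψ i) : PowerSeries k) = 0 :=
      constantCoeff_subst_arc_zero hΨ0 γ hγ0
    have hΓs : HasSubst (fun i => (MvPowerSeries.subst γ (Ψ i) : PowerSeries k)) := hasSubst_of_constantCoeff_zero hΓ0
    refine ⟨fun i => MvPowerSeries.subst γ (Ψ i), hΓ0, ?_, ?_, ?_, ?_, ?_⟩
    · show MvPowerSeries.subst γ (Ψ 0) = _
      rw [hΨ0X, subst_X hγs, hγ0e]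
    · show MvPowerSeries.subst γ (Ψ 1) = _
      rw [hΨ1X, subst_X hγs, hγ1e]
    · show A 2 2 * MvPowerSeries.coeff (Finsupp.single () 1) (MvPowerSeries.subst γ (Ψ 2)) = _
      rw [coeff_degree_one_subst γ hγ0 (Ψ 2) (Finsupp.single () 1) (by simp), Fin.sum_univ_three, hγ0e, hγ1e, hγ2e,
        hcX, hcX, map_zero, mul_zero, add_zero]
      have e0 : coeff (Finsupp.single 0 1) (Ψ 2) = B 2 0 := rfl
      have e1 : coeff (Finsupp.single 1 1) (Ψ 2) = B 2 1 := rfl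
      rw [e0, e1]
      linear_combination α * hB20 + β * hB21
    · rw [← subst_comp_subst_apply hΨ hγs, hΨm, subst_X hγs, hγ2e]
    · intro J
      have hpd0 : pd J (m ^ p) = 0 := by
        obtain ⟨q, hq⟩ : ∃ q, p = q + 1 := ⟨p - 1, (Nat.sub_add_cancel hp.out.one_le).symm⟩
        rw [hq, pd_pow_succ, ← hq, CharP.cast_eq_zero, zero_mul, zero_mul]
      rw [hpd0, ← coe_substAlgHom hΓs, map_zero]
  -- choose the direction `(α, β)` so that the arc leaves the centre `V(xᵢ : wᵢ > 0)`
  obtain ⟨i, hi⟩ := hwpos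
  have hchoice : ∃ α β : k, ∀ Γ : Fin 3 → PowerSeries k, Γ 0 = α • PowerSeries.X → Γ 1 = β • PowerSeries.X →
      A 2 2 * MvPowerSeries.coeff (Finsupp.single () 1) (Γ 2) = -(A 1 0 * α + A 1 1 * β) → Γ i ≠ 0 := by
    fin_cases i
    · refine ⟨1, 0, fun Γ h0 _ _ => ?_⟩
      show Γ 0 ≠ 0
      rw [h0, one_smul]
      exact PowerSeries.X_ne_zero
    · refine ⟨0, 1, fun Γ _ h1 _ => ?_⟩
      show Γ 1 ≠ 0
      rw [h1, one_smul]
      exact PowerSeries.X_ne_zero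
    · rcases h1011 with h10 | h11
      · refine ⟨1, 0, fun Γ _ _ h2 hΓ => h10 ?_⟩
        have hΓ' : Γ 2 = 0 := hΓ
        rw [hΓ', map_zero, mul_zero, mul_one, mul_zero, add_zero] at h2
        linear_combination h2
      · refine ⟨0, 1, fun Γ _ _ h2 hΓ => h11 ?_⟩
        have hΓ' : Γ 2 = 0 := hΓ
        rw [hΓ', map_zero, mul_zero, mul_zero, mul_one, zero_add] at h2
        linear_combination h2
  obtain ⟨α, β, hαβ⟩ := hchoice
  obtain ⟨Γ, hΓ0, hΓ0X, hΓ1X, hΓ2, hΓm, hΓpd⟩ := harc α β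
  have hΓs : HasSubst Γ := hasSubst_of_constantCoeff_zero hΓ0
  have hS : ∃ i, 0 < w i ∧ Γ i ≠ 0 := ⟨i, hi, hαβ Γ hΓ0X hΓ1X hΓ2⟩
  have hf : (MvPowerSeries.subst Γ (m ^ p) : PowerSeries k) = 0 := by
    rw [subst_pow hΓs, hΓm, zero_pow hp0.ne']
  obtain ⟨c', hc'conv, hoff, hall⟩ := exists_offVertex_singular_of_arc w (m ^ p) Γ hΓ0 hS hf hΓpd
  have hF : MvPowerSeries.subst (chart w c') (m ^ p) ≠ 0 := subst_chart_ne_zero w c' hc'conv (pow_ne_zero _ hmne)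
  obtain ⟨a', g', hfac, hndvd⟩ := CobordantVertexChart.exists_eq_X_pow_mul_not_dvd hF
  refine hno c' a' g' ⟨hoff, ?_, hndvd, hall a' g' hfac⟩
  rw [hsub, cruxChart_eq_chart_of_convention w c' hc'conv]
  exact hfac

/-- **THE SPECIMEN, ASSEMBLED** (every field of characteristic `p`): the successor `g = Z^p + (1+x)·y^p` of the umbrella is
graded-won with rank `0` in its propagated grading `succLattice ⊤ (p+1,p,p) (0,1,0)`, while its slice `sliceGerm x g = Z^p + y^p`
is NOT graded-won with rank `0` in the slice grading. [OURS · L1 W4.3] -/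
theorem gradedWonBy_zero_umbrella_and_not_slice [CharP k p] :
    GradedWonBy 0 4 (succLattice (⊤ : AddSubgroup (Fin 3 → ℤ)) ![p + 1, p, p] ![(0 : k), 1, 0])
        (X 1 ^ p + (1 + X 2) * X 3 ^ p : MvPowerSeries (Fin 4) k) ∧
      ¬ GradedWonBy 0 3 (sliceLattice (succLattice (⊤ : AddSubgroup (Fin 3 → ℤ)) ![p + 1, p, p] ![(0 : k), 1, 0]) 1)
        (sliceGerm 1 (X 1 ^ p + (1 + X 2) * X 3 ^ p : MvPowerSeries (Fin 4) k)) := by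
  refine ⟨gradedWonBy_zero_umbrella p _, ?_⟩
  rw [sliceGerm_umbrella p]
  exact not_gradedWonBy_zero_addPow p _ (single_zero_sub_single_two_notMem_sliceLattice_umbrella p)
    (single_one_sub_single_two_notMem_sliceLattice_umbrella p)

end AddPow

/-! ## §2 R3-T3 as typed is refutable -/

/-- **R3-T3 `gradedWonBy_slice_iff` AS TYPED (idea-1 Sketch v3 §5, «same rank» form) IS REFUTABLE.**  The universally
quantified statement — for every field, every `L`-homogeneous `F`, every `L`-graded move, every successor `g` at an exceptional
point `c` with `c_{i₀} ≠ 0 < w_{i₀}` and EVERY rank `α`, `GradedWonBy α (n+1) (succLattice L w c) g ↔ GradedWonBy α n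
(sliceLattice …) (sliceGerm i₀ g)` — fails at `α = 0` on the wild successor of card A's own umbrella `Z² + x·y²` over `𝔽₂`
(weights `(3,2,2)`, point `(0,1,0)`, `i₀ = x`): the successor `Z² + (1+x)·y²` is graded-won in ONE move, its slice `Z² + y²
= (Z+y)²` is not (`gradedWonBy_zero_umbrella_and_not_slice`).  What survives at the specimen is the rank-free form (companion
`gradedWonBy_one_addPow`: the slice IS graded-won, with rank exactly `1` — the one extra move kills the grading); whether
«graded-won `g` ↔ graded-won slice» holds in general is NOT decided here. [OURS · L1 W4.3] -/
theorem not_gradedWonBy_slice_iff_asTyped :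
    ¬ ∀ (k : Type) [Field k] (n : ℕ) (F : MvPowerSeries (Fin n) k) (L : AddSubgroup (Fin n → ℤ)),
        IsLHomogeneous L F → ∀ (θ : Fin n → MvPowerSeries (Fin n) k) (w : Fin n → ℕ), IsLGradedMove L θ w →
        ∀ (c : Fin n → k) (a : ℕ) (g : MvPowerSeries (Fin (n + 1)) k), IsSuccessorAt F θ w c a g →
        ∀ (i₀ : Fin n), c i₀ ≠ 0 → 0 < w i₀ → ∀ (α : Ordinal.{0}),
          (GradedWonBy α (n + 1) (succLattice L w c) g ↔
            GradedWonBy α n (sliceLattice (succLattice L w c) i₀) (sliceGerm i₀ g)) := by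
  intro H
  haveI : Fact (Nat.Prime 2) := ⟨Nat.prime_two⟩
  have h := H (ZMod 2) 3 (X 0 ^ 2 + X 1 * X 2 ^ 2) ⊤ (fun _ _ _ _ => AddSubgroup.mem_top _) (fun i => X i)
    ![2 + 1, 2, 2] (isLGradedMove_X ⊤ _ ⟨0, by simp⟩) ![(0 : ZMod 2), 1, 0] (2 * (2 + 1))
    (X 1 ^ 2 + (1 + X 2) * X 3 ^ 2) (isSuccessorAt_umbrella 2) 1 (by simp) (by simp) 0
  obtain ⟨hg, hh⟩ := gradedWonBy_zero_umbrella_and_not_slice (k := ZMod 2) 2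
  exact hh (h.mp hg)

end GradedGame

end Summit.ResolutionOfSingularities.ResolutionOfSingularities.Theorems
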